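import Mathlib.Algebra.Homology.DerivedCategory.Ext.ExactSequences
import Mathlib.Algebra.Homology.ShortComplex.Ab
import Literature.AlgebraicGeometry.Motives.EllAdicTowerAlgebra
import Literature.AlgebraicGeometry.Motives.EllAdicCohomologyFinitenessEtale
import HarnessLib

/-!
# The Bockstein sequences of `Hⁱ(Y_ét, ℤ/ℓᵐ)` and the proof of Milne V Lemma 1.11

This file **discharges** the named fact
`Literature.AlgebraicGeometry.Motives.exists_module_finite_towerLim_etaleCohomology`
(`EllAdicCohomologyFinitenessEtale.lean`; Milne, *Étale cohomology*, V Lemma 1.11 for the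
`ℓ`-adic sheaf `(ℤ/ℓᵐ)_m`): for a scheme `Y` and a prime `ℓ` such that all `Hⁱ(Y_ét, ℤ/ℓᵐ)`
(Mathlib's `Sheaf.H` of the constant sheaves on the small étale site, `EllAdicComparison.lean`)
are finite, `lim_m Hⁱ(Y_ét, ℤ/ℓᵐ)` is a finitely generated `ℤ_ℓ`-module — indeed for its
*canonical* `ℤ_ℓ`-module structure (`towerLim.instModulePadicInt`, `EllAdicTowerAlgebra.lean`):
`exists_module_finite_towerLim_etaleCohomology_holds`, `module_finite_towerLim_etaleCohomology`.
(The locally-Noetherian hypothesis of the fact, Milne's standing convention, is not used.)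

Consequently the group-level finiteness fact
`exists_addEquiv_geometricEllAdicCohomology k` (`Hⁱ_proét(X_{k̄}, ℤ_ℓ) ≃+ ℤ_ℓ^b × finite`)
now rests on exactly two named facts: Milne VI Cor. 2.8 (`finite_etaleCohomology_of_isProper`)
and Bhatt–Scholze Prop. 5.6.2 (`ellAdicCohomology_limOneSequence`):
`exists_addEquiv_geometricEllAdicCohomology_of_finiteness_of_comparison`.

## The proof (Milne V.1.11, p. 177, for `F = (ℤ/ℓᵐ)_m`)

* `zmodPowMul`, `zmodPowRedOne`, `shortExact_zmodPowShortComplex`: the short exact sequences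
  of abelian groups `0 → ℤ/ℓᵐ →(ℓ) ℤ/ℓᵐ⁺¹ → ℤ/ℓ → 0` ("on tensoring `0 → ℤ/(lⁿ) →(lˢ) ℤ/(lⁿ⁺ˢ) →
  ℤ/(lˢ) → 0` with `F_{n+s}`", here `s = 1`), in `Ab.{u}`, and the identities
  `red ≫ (ℓ·) = ℓ • 𝟙`, `(ℓ·) ≫ red = ℓ • 𝟙`, `red ≫ red = red` (`zmodPowAbRed_comp_mul`,
  `zmodPowMul_comp_red`, `zmodPowAbRed_comp_redOne`);
* the constant-sheaf functor to `Y_ét` is exact (`preservesFiniteLimits_constantSheaf_etale`,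
  `preservesFiniteColimits_constantSheaf_etale`: sheafification is left exact and a left
  adjoint), so these stay short exact as sequences of constant sheaves, and Mathlib's long exact
  `Ext`-sequence (`Ext.covariant_sequence_exact₂`) gives the exactness of the Bockstein sequence
  `Hⁱ(Y_ét, ℤ/ℓᵐ) →(ι) Hⁱ(Y_ét, ℤ/ℓᵐ⁺¹) → Hⁱ(Y_ét, ℤ/ℓ)` (`exists_etaleCohomologyZModPowMul_eq`),
  with `ι` natural in `m` and `ι ∘ red = ℓ •` (`etaleCohomologyZModPowMap_mul`,
  `etaleCohomologyZModPowMul_map`), and `ℓᵐ Hⁱ(Y_ét, ℤ/ℓᵐ) = 0` (`pow_smul_etaleCohomologyZModPow`);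
* the algebra of `EllAdicTowerAlgebra.lean` (`towerLim.module_finite_of_bockstein`): König's
  lemma turns this exactness into "`y ∈ lim` with `y₁ = 0` is divisible by `ℓ`", so
  `lim / ℓ ↪ Hⁱ(Y_ét, ℤ/ℓ)` is finite, `lim` is `ℓ`-adically separated, and Nakayama's lemma over
  the complete ring `ℤ_ℓ` (Mathlib `surjective_of_mkQ_comp_surjective`) gives finite generation —
  Milne's "it follows that `Hʳ(F)` is generated by any subset that generates it mod `l`".

## References

* J. S. Milne, *Étale cohomology* (2025 reissue, held copy), V Lemma 1.11, p. 177. [Milne2025]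
* B. Bhatt, P. Scholze, *The pro-étale topology for schemes*, Astérisque 369 (2015), Prop. 5.6.2
  (the remaining comparison fact). [BhattScholze2015]

## Design notes

* Only the case `s = 1` of Milne's Bockstein sequences is needed: Nakayama requires `lim/ℓ`
  finite and `lim` separated, not the full `ℓ`-adic completeness.
* `Sheaf.H.map (k • φ) = k • Sheaf.H.map φ` and `Hⁱ(0) = 0` (`sheafH_map_nsmul_apply`,
  `sheafH_map_zero_apply`) are proved here for a general site; Mathlib has `H.map_add_apply` only.
-/

noncomputable section

universe u

open CategoryTheory AlgebraicGeometry Abelian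

namespace Literature.AlgebraicGeometry.Motives

/-! ### The coefficient sequences `0 → ℤ/ℓⁿ →(ℓ) ℤ/ℓⁿ⁺¹ → ℤ/ℓ → 0` -/

section Coefficients

variable (ℓ : ℕ)

/-- A morphism `ℤ/ℓᵐ → ℤ/ℓⁿ` in `Ab.{u}` from an additive map (conjugation by `ULift`).
[folklore] -/
def zmodPowAbHom {m n : ℕ} (φ : ZMod (ℓ ^ m) →+ ZMod (ℓ ^ n)) :
    zmodPowAb.{u} ℓ m ⟶ zmodPowAb.{u} ℓ n :=
  AddCommGrpCat.ofHom <| AddEquiv.ulift.symm.toAddMonoidHom.comp <|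
    φ.comp AddEquiv.ulift.toAddMonoidHom

/-- `zmodPowAbHom φ` acts as `φ` on the underlying elements. [folklore] -/
@[simp] theorem zmodPowAbHom_apply {m n : ℕ} (φ : ZMod (ℓ ^ m) →+ ZMod (ℓ ^ n))
    (x : zmodPowAb.{u} ℓ m) : (zmodPowAbHom ℓ φ).hom x = ULift.up (φ x.down) :=
  rfl

/-- Two morphisms out of `ℤ/ℓᵐ` in `Ab` agree if they agree on the classes of integers.
[folklore] -/
theorem zmodPowAb_hom_ext {m : ℕ} {B : Ab.{u}} {g h : zmodPowAb.{u} ℓ m ⟶ B}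
    (w : ∀ k : ℤ, g.hom (ULift.up (k : ZMod (ℓ ^ m))) = h.hom (ULift.up (k : ZMod (ℓ ^ m)))) :
    g = h := by
  ext ⟨x⟩
  obtain ⟨k, rfl⟩ := ZMod.intCast_surjective x
  exact w k

/-- Multiplication by `ℓ`: the injection `ℤ/ℓⁿ → ℤ/ℓⁿ⁺¹`, `k ↦ ℓk`. [folklore] -/
def zmodPowMul (n : ℕ) : ZMod (ℓ ^ n) →+ ZMod (ℓ ^ (n + 1)) :=
  ZMod.lift (ℓ ^ n) ⟨(AddMonoidHom.mulLeft (ℓ : ZMod (ℓ ^ (n + 1)))).comp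
    (Int.castAddHom (ZMod (ℓ ^ (n + 1)))), by
      change (ℓ : ZMod (ℓ ^ (n + 1))) * ((ℓ ^ n : ℕ) : ℤ) = 0
      rw [Int.cast_natCast, Nat.cast_pow, ← pow_succ', ← Nat.cast_pow, ZMod.natCast_self]⟩

/-- `zmodPowMul` on the class of an integer `k` is the class of `ℓk`. [folklore] -/
@[simp] theorem zmodPowMul_intCast (n : ℕ) (k : ℤ) :
    zmodPowMul ℓ n (k : ZMod (ℓ ^ n)) = ℓ * (k : ZMod (ℓ ^ (n + 1))) :=
  ZMod.lift_coe _ _ k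

/-- The reduction `ℤ/ℓⁿ⁺¹ → ℤ/ℓ¹`. [folklore] -/
def zmodPowRedOne (n : ℕ) : ZMod (ℓ ^ (n + 1)) →+ ZMod (ℓ ^ 1) :=
  (ZMod.castHom (pow_dvd_pow ℓ (Nat.le_add_left 1 n)) (ZMod (ℓ ^ 1))).toAddMonoidHom

/-- `zmodPowRedOne` on the class of an integer `k` is the class of `k`. [folklore] -/
@[simp] theorem zmodPowRedOne_intCast (n : ℕ) (k : ℤ) :
    zmodPowRedOne ℓ n (k : ZMod (ℓ ^ (n + 1))) = (k : ZMod (ℓ ^ 1)) :=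
  map_intCast (ZMod.castHom (pow_dvd_pow ℓ (Nat.le_add_left 1 n)) (ZMod (ℓ ^ 1))) k

/-- `ℓ = 0` in `ℤ/ℓ¹`. [folklore] -/
theorem natCast_ell_zmodPowOne : (ℓ : ZMod (ℓ ^ 1)) = 0 := by
  rw [ZMod.natCast_eq_zero_iff, pow_one]

/-- Exactness of `ℤ/ℓⁿ →(ℓ) ℤ/ℓⁿ⁺¹ → ℤ/ℓ`. [folklore] -/
theorem exact_zmodPowMul_zmodPowRedOne (n : ℕ) :
    Function.Exact (zmodPowMul ℓ n) (zmodPowRedOne ℓ n) := by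
  intro y
  obtain ⟨k, rfl⟩ := ZMod.intCast_surjective y
  constructor
  · intro hk
    rw [zmodPowRedOne_intCast, ZMod.intCast_zmod_eq_zero_iff_dvd, Nat.cast_pow, pow_one] at hk
    obtain ⟨j, rfl⟩ := hk
    exact ⟨(j : ZMod (ℓ ^ n)), by rw [zmodPowMul_intCast, Int.cast_mul, Int.cast_natCast]⟩
  · rintro ⟨x, hx⟩
    obtain ⟨j, rfl⟩ := ZMod.intCast_surjective x
    rw [← hx, zmodPowMul_intCast, ← Int.cast_natCast, ← Int.cast_mul, zmodPowRedOne_intCast,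
      Int.cast_mul, Int.cast_natCast, natCast_ell_zmodPowOne, zero_mul]

/-- `ℤ/ℓⁿ →(ℓ) ℤ/ℓⁿ⁺¹` is injective (for `ℓ ≠ 0`). [folklore] -/
theorem zmodPowMul_injective [hℓ : Fact ℓ.Prime] (n : ℕ) :
    Function.Injective (zmodPowMul ℓ n) := by
  refine (injective_iff_map_eq_zero _).2 fun x hx => ?_
  obtain ⟨k, rfl⟩ := ZMod.intCast_surjective x
  rw [zmodPowMul_intCast, ← Int.cast_natCast, ← Int.cast_mul, ZMod.intCast_zmod_eq_zero_iff_dvd,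
    Nat.cast_pow, pow_succ'] at hx
  rw [ZMod.intCast_zmod_eq_zero_iff_dvd, Nat.cast_pow]
  exact (mul_dvd_mul_iff_left (by exact_mod_cast hℓ.out.ne_zero)).1 hx

/-- `ℤ/ℓⁿ⁺¹ → ℤ/ℓ` is surjective. [folklore] -/
theorem zmodPowRedOne_surjective (n : ℕ) : Function.Surjective (zmodPowRedOne ℓ n) :=
  ZMod.ringHom_surjective (ZMod.castHom (pow_dvd_pow ℓ (Nat.le_add_left 1 n)) (ZMod (ℓ ^ 1)))

/-- The coefficient short complex `ℤ/ℓⁿ →(ℓ) ℤ/ℓⁿ⁺¹ → ℤ/ℓ¹` in `Ab.{u}`. [folklore] -/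
def zmodPowShortComplex (n : ℕ) : ShortComplex Ab.{u} :=
  ShortComplex.mk (zmodPowAbHom.{u} ℓ (zmodPowMul ℓ n)) (zmodPowAbHom.{u} ℓ (zmodPowRedOne ℓ n))
    (by
      ext ⟨x⟩
      change zmodPowRedOne ℓ n (zmodPowMul ℓ n x) = 0
      exact (exact_zmodPowMul_zmodPowRedOne ℓ n).apply_apply_eq_zero x)

/-- The coefficient sequence `0 → ℤ/ℓⁿ →(ℓ) ℤ/ℓⁿ⁺¹ → ℤ/ℓ → 0` is short exact in `Ab`. [folklore] -/
theorem shortExact_zmodPowShortComplex [Fact ℓ.Prime] (n : ℕ) :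
    (zmodPowShortComplex.{u} ℓ n).ShortExact := by
  refine ShortComplex.ShortExact.mk' ?_ ?_ ?_
  · rw [ShortComplex.ab_exact_iff]
    rintro ⟨y⟩ hy
    have hy' : zmodPowRedOne ℓ n y = 0 := congrArg ULift.down hy
    obtain ⟨x, hx⟩ := ((exact_zmodPowMul_zmodPowRedOne ℓ n) y).1 hy'
    exact ⟨ULift.up x, congrArg ULift.up hx⟩
  · rw [AddCommGrpCat.mono_iff_injective]
    rintro ⟨x⟩ ⟨y⟩ h
    exact congrArg ULift.up (zmodPowMul_injective ℓ n (congrArg ULift.down h))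
  · rw [AddCommGrpCat.epi_iff_surjective]
    rintro ⟨y⟩
    obtain ⟨x, rfl⟩ := zmodPowRedOne_surjective ℓ n y
    exact ⟨ULift.up x, rfl⟩

/-- `(ℤ/ℓⁿ⁺¹ → ℤ/ℓⁿ) ≫ (ℤ/ℓⁿ →(ℓ) ℤ/ℓⁿ⁺¹) = ℓ • 𝟙`. [folklore] -/
theorem zmodPowAbRed_comp_mul (n : ℕ) :
    zmodPowAbRed.{u} ℓ n ≫ zmodPowAbHom.{u} ℓ (zmodPowMul ℓ n) =
      ℓ • 𝟙 (zmodPowAb.{u} ℓ (n + 1)) := by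
  refine zmodPowAb_hom_ext ℓ fun k => ?_
  change ULift.up (zmodPowMul ℓ n (ZMod.castHom (pow_dvd_pow ℓ n.le_succ) (ZMod (ℓ ^ n))
    (k : ZMod (ℓ ^ (n + 1))))) = ℓ • ULift.up (k : ZMod (ℓ ^ (n + 1)))
  rw [map_intCast, zmodPowMul_intCast, ← nsmul_eq_mul]
  rfl

/-- `(ℤ/ℓⁿ⁺¹ →(ℓ) ℤ/ℓⁿ⁺²) ≫ (ℤ/ℓⁿ⁺² → ℤ/ℓⁿ⁺¹) = ℓ • 𝟙`. [folklore] -/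
theorem zmodPowMul_comp_red (n : ℕ) :
    zmodPowAbHom.{u} ℓ (zmodPowMul ℓ (n + 1)) ≫ zmodPowAbRed.{u} ℓ (n + 1) =
      ℓ • 𝟙 (zmodPowAb.{u} ℓ (n + 1)) := by
  refine zmodPowAb_hom_ext ℓ fun k => ?_
  change ULift.up (ZMod.castHom (pow_dvd_pow ℓ (n + 1).le_succ) (ZMod (ℓ ^ (n + 1)))
    (zmodPowMul ℓ (n + 1) (k : ZMod (ℓ ^ (n + 1))))) = ℓ • ULift.up (k : ZMod (ℓ ^ (n + 1)))
  rw [zmodPowMul_intCast, map_mul, map_natCast, map_intCast, ← nsmul_eq_mul]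
  rfl

/-- The reduction `ℤ/ℓ¹ → ℤ/ℓ¹` is the identity. [folklore] -/
theorem zmodPowAbHom_zmodPowRedOne_zero :
    zmodPowAbHom.{u} ℓ (zmodPowRedOne ℓ 0) = 𝟙 (zmodPowAb.{u} ℓ 1) := by
  refine zmodPowAb_hom_ext ℓ fun k => ?_
  change ULift.up (zmodPowRedOne ℓ 0 (k : ZMod (ℓ ^ 1))) = ULift.up (k : ZMod (ℓ ^ 1))
  rw [zmodPowRedOne_intCast]

/-- Reducing `ℤ/ℓⁿ⁺² → ℤ/ℓⁿ⁺¹ → ℤ/ℓ¹` is reducing `ℤ/ℓⁿ⁺² → ℤ/ℓ¹`. [folklore] -/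
theorem zmodPowAbRed_comp_redOne (n : ℕ) :
    zmodPowAbRed.{u} ℓ (n + 1) ≫ zmodPowAbHom.{u} ℓ (zmodPowRedOne ℓ n) =
      zmodPowAbHom.{u} ℓ (zmodPowRedOne ℓ (n + 1)) := by
  refine zmodPowAb_hom_ext ℓ fun k => ?_
  change ULift.up (zmodPowRedOne ℓ n (ZMod.castHom (pow_dvd_pow ℓ (n + 1).le_succ)
    (ZMod (ℓ ^ (n + 1))) (k : ZMod (ℓ ^ (n + 2))))) =
    ULift.up (zmodPowRedOne ℓ (n + 1) (k : ZMod (ℓ ^ (n + 2))))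
  rw [map_intCast, zmodPowRedOne_intCast, zmodPowRedOne_intCast]

end Coefficients

/-! ### Sheaf cohomology: scalar multiples of maps -/

section SheafH

variable {C : Type*} [Category C] {J : GrothendieckTopology C}
  [HasSheafify J AddCommGrpCat.{u}] [HasExt.{u} (Sheaf J AddCommGrpCat.{u})]

/-- `Hⁱ` of the zero morphism is zero. [folklore] -/
theorem sheafH_map_zero_apply {F G : Sheaf J AddCommGrpCat.{u}} (i : ℕ) (x : Sheaf.H F i) :
    Sheaf.H.map (0 : F ⟶ G) i x = 0 := by
  rw [Sheaf.H.map_apply, Ext.mk₀_zero, Ext.comp_zero]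

/-- `Hⁱ` of `k • φ` is `k • Hⁱ(φ)`. [folklore] -/
theorem sheafH_map_nsmul_apply {F G : Sheaf J AddCommGrpCat.{u}} (φ : F ⟶ G) (k i : ℕ)
    (x : Sheaf.H F i) : Sheaf.H.map (k • φ) i x = k • Sheaf.H.map φ i x := by
  induction k with
  | zero => rw [zero_smul, zero_smul, sheafH_map_zero_apply]
  | succ k ih => rw [succ_nsmul, Sheaf.H.map_add_apply, ih, succ_nsmul]

/-- If `k • 𝟙 F = 0` then `k` kills `Hⁱ(F)`. [folklore] -/
theorem nsmul_sheafH_eq_zero {F : Sheaf J AddCommGrpCat.{u}} {k : ℕ} (hk : k • 𝟙 F = 0) (i : ℕ)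
    (x : Sheaf.H F i) : k • x = 0 := by
  rw [← Sheaf.H.map_id_apply x, ← sheafH_map_nsmul_apply, hk, sheafH_map_zero_apply]

end SheafH

/-! ### The Bockstein data of the tower `m ↦ Hⁱ(Y_ét, ℤ/ℓᵐ)` -/

section Etale

variable (Y : Scheme.{u}) (ℓ : ℕ) (i : ℕ)

/-- The constant-sheaf functor to the small étale site preserves finite limits (the
constant-presheaf functor does, and sheafification is left exact). [folklore] -/
theorem preservesFiniteLimits_constantSheaf_etale :
    Limits.PreservesFiniteLimits (constantSheaf Y.smallEtaleTopology Ab.{u}) := by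
  haveI : Limits.PreservesFiniteLimits
      (Functor.const (Scheme.Etale Y)ᵒᵖ : Ab.{u} ⥤ (Scheme.Etale Y)ᵒᵖ ⥤ Ab.{u}) :=
    ⟨fun _ _ _ => inferInstance⟩
  exact Limits.comp_preservesFiniteLimits (Functor.const (Scheme.Etale Y)ᵒᵖ)
    (presheafToSheaf Y.smallEtaleTopology Ab.{u})

/-- The constant-sheaf functor to the small étale site preserves finite colimits (a composite of
left adjoints). [folklore] -/
theorem preservesFiniteColimits_constantSheaf_etale :
    Limits.PreservesFiniteColimits (constantSheaf Y.smallEtaleTopology Ab.{u}) := by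
  haveI : Limits.PreservesFiniteColimits
      (Functor.const (Scheme.Etale Y)ᵒᵖ : Ab.{u} ⥤ (Scheme.Etale Y)ᵒᵖ ⥤ Ab.{u}) :=
    ⟨fun _ _ _ => inferInstance⟩
  haveI : Limits.PreservesColimitsOfSize.{0, 0} (presheafToSheaf Y.smallEtaleTopology Ab.{u}) :=
    (sheafificationAdjunction Y.smallEtaleTopology Ab.{u}).leftAdjoint_preservesColimits
  haveI : Limits.PreservesFiniteColimits (presheafToSheaf Y.smallEtaleTopology Ab.{u}) :=
    ⟨fun _ _ _ => inferInstance⟩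
  exact Limits.comp_preservesFiniteColimits (Functor.const (Scheme.Etale Y)ᵒᵖ)
    (presheafToSheaf Y.smallEtaleTopology Ab.{u})

/-- `Hⁱ(Y_ét, ℤ/ℓᵐ)` is killed by `ℓᵐ`. [folklore] -/
theorem pow_smul_etaleCohomologyZModPow (m : ℕ) (a : etaleCohomologyZModPow Y ℓ i m) :
    ℓ ^ m • a = 0 :=
  nsmul_sheafH_eq_zero (nsmul_id_constantSheaf_zmodPowAb Y ℓ m) i a

/-- The Bockstein map `ι_m : Hⁱ(Y_ét, ℤ/ℓᵐ) → Hⁱ(Y_ét, ℤ/ℓᵐ⁺¹)` induced by `ℓ : ℤ/ℓᵐ ↪ ℤ/ℓᵐ⁺¹`.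
[cite: Milne2025, V Lemma 1.11 (proof)] -/
def etaleCohomologyZModPowMul (m : ℕ) :
    etaleCohomologyZModPow Y ℓ i m →+ etaleCohomologyZModPow Y ℓ i (m + 1) :=
  Sheaf.H.map ((constantSheaf Y.smallEtaleTopology Ab.{u}).map
    (zmodPowAbHom.{u} ℓ (zmodPowMul ℓ m))) i

/-- Naturality of the Bockstein maps with respect to the reductions. [folklore] -/
theorem etaleCohomologyZModPowMap_mul (m : ℕ) (a : etaleCohomologyZModPow Y ℓ i (m + 1)) :
    etaleCohomologyZModPowMap Y ℓ i (m + 1) (etaleCohomologyZModPowMul Y ℓ i (m + 1) a) =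
      etaleCohomologyZModPowMul Y ℓ i m (etaleCohomologyZModPowMap Y ℓ i m a) := by
  unfold etaleCohomologyZModPowMap etaleCohomologyZModPowMul
  rw [← Sheaf.H.map_comp_apply, ← Functor.map_comp, zmodPowMul_comp_red,
    ← Sheaf.H.map_comp_apply, ← Functor.map_comp, zmodPowAbRed_comp_mul]

/-- `ι_m (red a) = ℓ • a` on `Hⁱ(Y_ét, ℤ/ℓᵐ⁺¹)`. [folklore] -/
theorem etaleCohomologyZModPowMul_map (m : ℕ) (a : etaleCohomologyZModPow Y ℓ i (m + 1)) :
    etaleCohomologyZModPowMul Y ℓ i m (etaleCohomologyZModPowMap Y ℓ i m a) = ℓ • a := by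
  unfold etaleCohomologyZModPowMap etaleCohomologyZModPowMul
  rw [← Sheaf.H.map_comp_apply, ← Functor.map_comp, zmodPowAbRed_comp_mul, Functor.map_nsmul,
    CategoryTheory.Functor.map_id, sheafH_map_nsmul_apply, Sheaf.H.map_id_apply]

/-- The composite reduction `Hⁱ(Y_ét, ℤ/ℓᵐ⁺¹) → Hⁱ(Y_ét, ℤ/ℓ¹)` is induced by `ℤ/ℓᵐ⁺¹ → ℤ/ℓ¹`.
[folklore] -/
theorem toLevelOne_etaleCohomologyZModPowMap (m : ℕ)
    (a : etaleCohomologyZModPow Y ℓ i (m + 1)) :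
    towerLim.toLevelOne (etaleCohomologyZModPowMap Y ℓ i) m a =
      Sheaf.H.map ((constantSheaf Y.smallEtaleTopology Ab.{u}).map
        (zmodPowAbHom.{u} ℓ (zmodPowRedOne ℓ m))) i a := by
  induction m with
  | zero =>
    change a = _
    rw [zmodPowAbHom_zmodPowRedOne_zero, CategoryTheory.Functor.map_id, Sheaf.H.map_id_apply]
  | succ m ih =>
    change towerLim.toLevelOne (etaleCohomologyZModPowMap Y ℓ i) m
      (etaleCohomologyZModPowMap Y ℓ i (m + 1) a) = _
    rw [ih, etaleCohomologyZModPowMap, ← Sheaf.H.map_comp_apply, ← Functor.map_comp,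
      zmodPowAbRed_comp_redOne]

variable [Fact ℓ.Prime]

/-- **Exactness of the Bockstein sequence** `Hⁱ(Y_ét, ℤ/ℓᵐ) →(ι) Hⁱ(Y_ét, ℤ/ℓᵐ⁺¹) → Hⁱ(Y_ét, ℤ/ℓ)`
(the long exact cohomology sequence of the short exact sequence of constant sheaves
`0 → ℤ/ℓᵐ → ℤ/ℓᵐ⁺¹ → ℤ/ℓ → 0`, exact because the constant-sheaf functor is exact; Mathlib
`Ext.covariant_sequence_exact₂`). [cite: Milne2025, V Lemma 1.11 (proof)] -/
theorem exists_etaleCohomologyZModPowMul_eq (m : ℕ) (a : etaleCohomologyZModPow Y ℓ i (m + 1))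
    (ha : towerLim.toLevelOne (etaleCohomologyZModPowMap Y ℓ i) m a = 0) :
    ∃ w, etaleCohomologyZModPowMul Y ℓ i m w = a := by
  haveI := preservesFiniteLimits_constantSheaf_etale Y
  haveI := preservesFiniteColimits_constantSheaf_etale Y
  have hS := (shortExact_zmodPowShortComplex.{u} ℓ m).map_of_exact
    (constantSheaf Y.smallEtaleTopology Ab.{u})
  rw [toLevelOne_etaleCohomologyZModPowMap, Sheaf.H.map_apply] at ha
  obtain ⟨w, hw⟩ := Ext.covariant_sequence_exact₂ _ hS a ha
  exact ⟨w, by rw [etaleCohomologyZModPowMul, Sheaf.H.map_apply]; exact hw⟩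

/-- **Milne V Lemma 1.11 for `(ℤ/ℓᵐ)_m`, proved**: if `Hⁱ(Y_ét, ℤ/ℓᵐ)` is finite for all `m`,
then `lim_m Hⁱ(Y_ét, ℤ/ℓᵐ)` with its canonical `ℤ_ℓ`-module structure
(`towerLim.instModulePadicInt`) is finitely generated. [cite: Milne2025, V Lemma 1.11] -/
theorem module_finite_towerLim_etaleCohomology
    (hfin : ∀ m, Finite (etaleCohomologyZModPow Y ℓ i m)) :
    ∃ _ : Module ℤ_[ℓ] (towerLim (etaleCohomologyZModPowMap Y ℓ i)),
      Module.Finite ℤ_[ℓ] (towerLim (etaleCohomologyZModPowMap Y ℓ i)) := by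
  haveI : Fact (∀ m (a : etaleCohomologyZModPow Y ℓ i m), ℓ ^ m • a = 0) :=
    ⟨pow_smul_etaleCohomologyZModPow Y ℓ i⟩
  haveI := hfin
  exact ⟨inferInstance, towerLim.module_finite_of_bockstein (etaleCohomologyZModPowMap Y ℓ i) ℓ
    (etaleCohomologyZModPowMul Y ℓ i) (etaleCohomologyZModPowMap_mul Y ℓ i)
    (etaleCohomologyZModPowMul_map Y ℓ i) (exists_etaleCohomologyZModPowMul_eq Y ℓ i)⟩

end Etale

/-- **Discharge of the named fact `exists_module_finite_towerLim_etaleCohomology`**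
(Milne V Lemma 1.11 for the `ℓ`-adic sheaf `(ℤ/ℓᵐ)_m`). [cite: Milne2025, V Lemma 1.11] -/
theorem exists_module_finite_towerLim_etaleCohomology_holds :
    exists_module_finite_towerLim_etaleCohomology.{u} := by
  intro Y _ ℓ _ hfin i
  exact module_finite_towerLim_etaleCohomology Y ℓ i (fun m => hfin i m)

/-- **`Hʲ⁺¹_proét(Y, ℤ_ℓ) ≃+ ℤ_ℓ^b × (finite)` for `Y` proper over a separably closed field, from
Milne VI Cor. 2.8 and Bhatt–Scholze Prop. 5.6.2 alone** (Milne V.1.11 being proved,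
`exists_module_finite_towerLim_etaleCohomology_holds`).
[cite: Milne2025, V Lemma 1.11 and VI Cor. 2.8] [cite: BhattScholze2015, Prop. 5.6.2] -/
theorem exists_addEquiv_ellAdicCohomology_succ_of_finiteness_of_comparison
    (h₂ : finite_etaleCohomology_of_isProper.{u}) (h₃ : ellAdicCohomology_limOneSequence.{u})
    {K : Type u} [Field K] [IsSepClosed K] {Y : Scheme.{u}} (f : Y ⟶ Spec (CommRingCat.of K))
    [IsProper f] (ℓ : ℕ) [Fact ℓ.Prime] (j : ℕ) :
    ∃ (b : ℕ) (T : Type) (_ : AddCommGroup T) (_ : Finite T),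
      Nonempty (Y.EllAdicCohomology ℓ (j + 1) ≃+ (Fin b → ℤ_[ℓ]) × T) :=
  exists_addEquiv_ellAdicCohomology_succ_of_etale_facts h₂ h₃
    exists_module_finite_towerLim_etaleCohomology_holds f ℓ j

/-- **`exists_addEquiv_geometricEllAdicCohomology` from Milne VI Cor. 2.8 and Bhatt–Scholze
Prop. 5.6.2** (its trust base after this file): for `X` smooth projective geometrically
irreducible over any field `k`, every prime `ℓ` and every `i`, `Hⁱ_proét(X_{k̄}, ℤ_ℓ) ≃+ ℤ_ℓ^b × T`
with `T` finite, conditionally only on the finiteness theorem for `Hⁱ(Y_ét, ℤ/n)` of proper `Y`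
(`finite_etaleCohomology_of_isProper`) and the pro-étale/étale `lim¹` sequence
(`ellAdicCohomology_limOneSequence`). [cite: Milne2025, V Lemma 1.11 and VI Cor. 2.8]
[cite: BhattScholze2015, Prop. 5.6.2] -/
theorem exists_addEquiv_geometricEllAdicCohomology_of_finiteness_of_comparison
    (h₂ : finite_etaleCohomology_of_isProper.{u}) (h₃ : ellAdicCohomology_limOneSequence.{u})
    (k : Type u) [Field k] : exists_addEquiv_geometricEllAdicCohomology k :=
  exists_addEquiv_geometricEllAdicCohomology_of_etale_facts k h₂ h₃
    exists_module_finite_towerLim_etaleCohomology_holds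

end Literature.AlgebraicGeometry.Motives

end
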